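/-
Origin: expansion seat `planner-pub-hodgecm-mc-axioms-1-g14-0`, handover #W197 2026-08-20T15:53:55Z md5 c539a02c8b32 (PKG a093fe23c5fe → c539a02c8b32; 380 l.; MECHANICAL (iib-R) rewrite v3.1 of the PKG file as it stands (90 token edits; rules R1x1+RX[h₂]x89)) (`HOME/mc/pub-hodgecm-mc-axioms-1-g14/revendor/kit-r55/stage55/HodgeCM/Model/Binders/Real34GenMem.lean`, md5 c539a02c8b32, 380 lines);
landed by the gen-22 packager (p-g22) in gate run 55 REPLACES the earlier landed copy of `HodgeCM/Model/Binders/Real34GenMem.lean` (seat copy carried the packager Origin header of an earlier run (stripped)).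
-/
/-
Origin: DISCHARGE seat `prover-pub-hodgecm-mc-discharge-1-g16-0` (unit pub-hodgecm-mc-discharge-1-g16, gen 16 of mc-discharge-1), ticket **D-6**
of `HOME/BINDER-OWNERS.md` = §1a row 15 `real34`, sub-item (K34) `gen_mem` (over binder-1's `Real34Loc.wset`; r2: `wset34`) (desk ruling (FFFFFF′) 2026-08-19T16:43:12Z,
content gate model1-g7 (K34-elig) 16:47:53Z «SEAT-ELIGIBLE NOW», claim 16:48:47Z), 2026-08-19.  NEW additive PKG leaf
`HodgeCM/Model/Binders/Real34GenMem.lean` (path word model1-g7 ✓; sibling of binder-1's `Real34Seesaw` #8 / `Real34MeetProj` #13 /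
`Real34Meet` #14 / `Real34OfJunctions` #15).  Imports binder-1's RUN-36 kit rows #8 `Model/Binders/Real34Seesaw`, #10 `Model/Binders/Gen12RepOfSat` (binder-1-g7 kit) and #15 r3
`Model/Binders/Real34OfJunctions` (binder-1-g8 kit `t36-mcbinder1g8.txt`: records `Real34Loc` / `Real34Junctions`, set `Real34Loc.wset`; r2's
`wset34` is WITHDRAWN) — ‴ world at RUN 36, (W1) world at RUN 37 through mc-discharge-1's `Gen12ProjDischarge` ⁗ — and the PKG shell file
`Model/Binders/MeetBridgesShells` (RUN 32, binder-2 custody — CONSUMED, not edited).  r3 of this leaf (r1 ecf636b9cb4b / r2 3ed077018cde were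
cut against binder-1's withdrawn r2 and are superseded before any intake).  Nothing
installed imports this file.  KERNEL ONLY: 0 records, 0 `def … : Prop`, 0 proof holes, nothing cited, MODEL-N ±0, E text untouched.
Expected `#print axioms`: {propext, Classical.choice, Quot.sound}.
-/
import Summits.HodgeConjecture.HodgeCM.Model.Binders.Real34Seesaw
import Summits.HodgeConjecture.HodgeCM.Model.Binders.Gen12RepOfSat
import Summits.HodgeConjecture.HodgeCM.Model.Binders.Real34OfJunctions
import Summits.HodgeConjecture.HodgeCM.Model.Binders.MeetBridgesShells


/-!
# Row `real34`, sub-item (K34): `gen_mem` over the admissible-representative `wset` — the certain reductions and the (K34) junction theorem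

E's binder `real34` is reduced by binder-1's `Model/Binders/Real34OfJunctions` r3 (`real34_of_junctions`) to a junction record
`Real34Junctions = Real34Loc ⊕ {(K34) gen_mem, hι, C3₂, C3₃}` per good sextic context (plus the universe facts, (J-cov′) and (E3)), where

  (K34)  `gen_mem : ∀ χ Φ, ((pinT …).t34 V c).ϑ χ Φ ∈ (Submodule.span ℂ J.wset).topologicalClosure`

(PerL v5 Lemma 3.5, the (34) half, in FUNCTION form) and `J.wset` (`Real34Loc.wset`, `Model/Binders/Real34Meet` r3 :130) is the set of
realised global wedge-functions `realise (G₃ ∧ G₄)` of ADMISSIBLE (`J.Rep`) adelic theta representatives of types `2`, `3` at a common level.  This file types the two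
reductions of (K34) that are CERTAIN (model1-g7 (K34-elig) scope (b), first clause), so that the content which remains is exactly
ONE named object:

* § 1 `ϑ_mem_closure_span_of_dense` / **`Real34Loc.gen_mem_of_dense`** — density + continuity (PerL ll. 358–359; pattern of PKG
  `QautCore.ϑ_mem_closure_span` / `PerL34.S12Wedges.N19g_of`, engine = the interface field AX5b through `PerL34.continuous_ϑ`): if on a
  DENSE subset `P ⊆ 𝒮^κ` every generator `ϑ₃₄(χ, Φ)`, `Φ ∈ P`, is a FINITE linear combination of elements of `J.wset`, then (K34) holds.
  Stated for an arbitrary theta model / torus datum / target set first (`ϑ_mem_closure_span_of_dense`), then at the pin.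
* § 2 **`Real34Loc.gen_mem_of_qautCore`** — the typed route already in the package: a `QautCore` of the pinned model with torus datum
  `t34 V c` (binder-2's analytic shell, `Model/Binders/MeetBridgesShells` :188ff: compact `K`, Banach algebra `C`, right translation `σ`,
  `ρ = 𝔭₊`, `k₀`, `ξ`, `toHG`, `Forms₁/₂`, dense `P`, `decomp`) whose global wedge-functions `toHG (u ∧ v)` lie in the span of `J.wset`
  gives (K34) (`QautCore.ϑ_mem_closure_span` + monotonicity of `topologicalClosure ∘ span`).
* § 4 **`Real34Loc.gen_mem_of_kType`** — § 1 unfolded one level in the producers' currencies: (K34) from (α) the (34) see-saw hypotheses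
  `H : SeesawHyp34` (binder-1 #8's record; producer period-1, (S-restr) lines `k = 2, 3`), `hRep` (generating theta forms of admissible
  situations are `J.Rep`-admissible — DEFINITIONAL for binder-1's RUN-37 instance `Rep Γ i G := G ∈ span (thetaGen Γ i adm)`, so (ε) drops), and the K-TYPE CONTENT
  `hP` + `hdec` (a dense `P ⊆ 𝒮^κ` of finite combinations of wedge tensors of frame vectors of admissible situations) — via the
  pointwise identities `torusPeriodW₃₄_wedgeTensor`, `linePeriod_eq_coord_thetaGenElt`, `t34_ϑ_eq_smul_realise_of_torusPeriodW₃₄`,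
  `t34_ϑ_wedgeTensor_eq_smul_realise`, `t34_ϑ_eq_smul_sum_realise_wedge₂`.
* § 3 **`Real34Loc.junctions_of_dense`** / **`_of_qautCore`** / **`_of_kType`** — the E-facing plumbing: either datum, together with
  D-1′'s `hι` and C3₂, C3₃, extends `J` to binder-1's `Real34Junctions` (whose `funBridge` / `real34_of_junctions` take the universe facts,
  (J-cov′) and (E3)) — so the ONLY content left on row 15's (K34) after this file is the finite-sum statement on a dense `P`
  (§ 1's `hspan` + `hP`; § 4's `hdec` + `hP`), equivalently the `decomp` field of a `J.wset`-compatible `QautCore` at the pin (§ 2).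

What that remaining content IS (model1-g7 input map, recorded here so the successor starts from it; none of it is used below):
(α) see-saw on pure tensors = binder-1 #8 `t34_ϑc_mk_eq_smul_integral_mul_integral (H : SeesawHyp34 …)`; (β) `K_{ι₁}`-weights of the
period factors = Fock degrees (tree `KonnoKonno2007/JunctionBallFrameHarmonics`, `SegalBargmann/FockPolynomialWeights`, …); (γ) density of
the Hermite-finite pure tensors in `𝒮^κ` (tree `SegalBargmann/HermiteExpansionSchwartz`, `HermiteMultiplierStrongContinuity`, `FockKFiniteDense`);
(δ) = § 1's engine, done here; (ε) weight-one factors are components of saturated representatives of theta one-forms (binder-1 #10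
`exists_rep_of_saturated` + CLASSMAP) — in r3 this is binder-1's `Real34Loc.descend`/`sat` of the instance, not an input of this file.  Nothing here is a claim of the manuscripts under adjudication.
-/

set_option autoImplicit false

noncomputable section

open scoped InnerProductSpace Matrix
open MeasureTheory MulAction Literature.MeasureTheory.Group
open Literature.NumberTheory.Automorphic Literature.NumberTheory.Automorphic.UnitaryGroup
open Literature.NumberTheory.Automorphic.LevelOrbit
open Literature.Geometry.ComplexHyperbolic.BallModel (U21 Ball x₀ Jac)
open Literature.AlgebraicGeometry.ShimuraVarieties
open NumberField
open HodgeCM.Prior.Perl34File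

namespace HodgeCM

namespace Model

open Literature.AlgebraicGeometry.HodgeTheory
open Literature.NumberTheory.Automorphic.PicardCM
open Literature.NumberTheory.Transcendental (Arapura2012_Cor_15_4_6)
open Literature.NumberTheory.Weil1964
open HodgeCM.Model.ThetaSpace HodgeCM.Model.SupplyResidual

/-! ## 1. Density + continuity: (K34) from a finite-sum statement on a dense subset of `𝒮^κ` -/

/-- **Closure-span membership from a dense subset** (PerL ll. 358–359 «by continuity of `ϑ_{T,χ}` it suffices to treat `Φ` in a dense
subspace»), for ANY theta model `T`, torus datum `D` of `T.core V c` and target set `Wset ⊆ HG`: if every generator `D.ϑ χ Φ` with `Φ`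
in a dense `P ⊆ 𝒮^κ` is a finite linear combination of elements of `Wset`, then every generator lies in the closed span of `Wset`.
Engine: the interface's own continuity field AX5b (`PerL34.continuous_ϑ`). -/
theorem ϑ_mem_closure_span_of_dense {U : Universe} (T : U.ThetaModel)
    {L : CMField} {ι₁ : L →+* ℂ} (V : HermSpace3 L ι₁) (c : SeesawCtx L) (D : Perl34.TorusData (T.core V c))
    (Wset : Set (T.HG L ι₁ V)) {P : Set (T.SK V c)} (hP : Dense P)
    (hspan : ∀ (χ : D.X), ∀ Φ ∈ P, D.ϑ χ Φ ∈ Submodule.span ℂ Wset) (χ : D.X) (Φ : T.SK V c) :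
    D.ϑ χ Φ ∈ (Submodule.span ℂ Wset).topologicalClosure := by
  have hΦ : Φ ∈ closure P := by rw [hP.closure_eq]; exact Set.mem_univ Φ
  have h1 : D.ϑ χ Φ ∈ closure ((fun Ψ : T.SK V c => D.ϑ χ Ψ) '' P) :=
    image_closure_subset_closure_image (PerL34.continuous_ϑ T V c D χ) ⟨Φ, hΦ, rfl⟩
  rw [← SetLike.mem_coe, Submodule.topologicalClosure_coe]
  refine closure_mono ?_ h1
  rintro _ ⟨Ψ, hΨ, rfl⟩
  exact hspan χ Ψ hΨ

variable (hHD : exists_isReal_hodgeModel) (hI : hodgePQ_independent_of_hodgeModel)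
  (h₁ : BallQuotientUniformised)  (h₃ : CMAbelianVarietyRealised)
variable (h : Bool) (hA : Arapura2012_Cor_15_4_6)
  (W : ∀ {L : CMField} {ι₁ : L →+* ℂ} (V : HermSpace3 L ι₁) (c : SeesawCtx L), WmInput V c.D)
  (S : ∀ {L : CMField} {ι₁ : L →+* ℂ} (V : HermSpace3 L ι₁) (c : SeesawCtx L), ThetaAdelicSide V c)
  (μ : ∀ {L : CMField}, SeesawCtx L → Fin 4 → InfinitePlace L → ℤ)

variable {L : CMField} {ι₁ : L →+* ℂ} (V : HermSpace3 L ι₁) (c : SeesawCtx L) (hV : IsAnisotropic L V.Hm)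

/-- **(K34) from a finite-sum statement on a dense subset of `𝒮^κ`** (§ 1 at the pin, for a (34) junction record `J`): `gen_mem` over
`J.wset` — binder-1's `Real34Junctions.gen_mem` text VERBATIM as the conclusion — follows from `hP : Dense P` and
`hspan : ∀ χ, ∀ Φ ∈ P, ϑ₃₄(χ, Φ) ∈ span ℂ J.wset`. -/
theorem Real34Loc.gen_mem_of_dense (J : Real34Loc hHD hI h₁ h₃ h hA W S μ V c hV)
    {P : Set ((pinT hHD hI h₁ h₃ h hA W S μ).SK V c)} (hP : Dense P)
    (hspan : ∀ (χ : ((pinT hHD hI h₁ h₃ h hA W S μ).t34 V c).X), ∀ Φ ∈ P,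
      ((pinT hHD hI h₁ h₃ h hA W S μ).t34 V c).ϑ χ Φ ∈ Submodule.span ℂ J.wset) :
    ∀ (χ : ((pinT hHD hI h₁ h₃ h hA W S μ).t34 V c).X) (Φ : (pinT hHD hI h₁ h₃ h hA W S μ).SK V c),
      ((pinT hHD hI h₁ h₃ h hA W S μ).t34 V c).ϑ χ Φ ∈ (Submodule.span ℂ J.wset).topologicalClosure :=
  ϑ_mem_closure_span_of_dense (pinT hHD hI h₁ h₃ h hA W S μ) V c ((pinT hHD hI h₁ h₃ h hA W S μ).t34 V c) J.wset hP hspan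

/-! ## 2. (K34) from a `J.wset`-compatible Qaut core at the pin -/

/-- **(K34) from binder-2's analytic shell**: a `QautCore` of the pinned theta model with torus datum `t34 V c` whose global
wedge-functions `toHG (u ∧ v)` (`u ∈ Forms₁ χ`, `v ∈ Forms₂ χ`) are finite combinations of elements of `J.wset` gives `gen_mem` over
`J.wset` (Lemma 3.5 (34) function form `QautCore.ϑ_mem_closure_span`, then `span`/`topologicalClosure` monotonicity). -/
theorem Real34Loc.gen_mem_of_qautCore (J : Real34Loc hHD hI h₁ h₃ h hA W S μ V c hV)
    (B : (pinT hHD hI h₁ h₃ h hA W S μ).QautCore V c ((pinT hHD hI h₁ h₃ h hA W S μ).t34 V c))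
    (hB : B.wset ⊆ (Submodule.span ℂ J.wset : Set ((pinT hHD hI h₁ h₃ h hA W S μ).HG L ι₁ V))) :
    ∀ (χ : ((pinT hHD hI h₁ h₃ h hA W S μ).t34 V c).X) (Φ : (pinT hHD hI h₁ h₃ h hA W S μ).SK V c),
      ((pinT hHD hI h₁ h₃ h hA W S μ).t34 V c).ϑ χ Φ ∈ (Submodule.span ℂ J.wset).topologicalClosure :=
  fun χ Φ => Submodule.topologicalClosure_mono (Submodule.span_le.mpr hB) (B.ϑ_mem_closure_span χ Φ)

/-! ## 3. The E-facing plumbing: binder-1's junction record from either datum -/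

/-- **`Real34Junctions` from a finite-sum statement on a dense subset of `𝒮^κ`** (§ 1), D-1′'s frame junction `hι` and C3 for types `2`, `3`
(then binder-1's `Real34Junctions.funBridge` / `real34_of_junctions` take the universe facts, (J-cov′) and (E3)). -/
def Real34Loc.junctions_of_dense (J : Real34Loc hHD hI h₁ h₃ h hA W S μ V c hV)
    {P : Set ((pinT hHD hI h₁ h₃ h hA W S μ).SK V c)} (hP : Dense P)
    (hspan : ∀ (χ : ((pinT hHD hI h₁ h₃ h hA W S μ).t34 V c).X), ∀ Φ ∈ P,
      ((pinT hHD hI h₁ h₃ h hA W S μ).t34 V c).ϑ χ Φ ∈ Submodule.span ℂ J.wset)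
    (hι : ∀ u : U21, (S V c).ιinf u =
      Adelic.regimeEquiv L V.Hm hV (archSectionU21CM (L : Type) ι₁ V.Hm V.sylvesterFrame (sylvesterFrame_J V) u))
    (hU₂ : ∀ Γ : Level V, (pinT hHD hI h₁ h₃ h hA W S μ).Theta V c 2 Γ ⊆ (picardCMUniverse hHD hI h₁ h₃).Uiso Γ c.K (c.Ψ 2) c.σ)
    (hU₃ : ∀ Γ : Level V, (pinT hHD hI h₁ h₃ h hA W S μ).Theta V c 3 Γ ⊆ (picardCMUniverse hHD hI h₁ h₃).Uiso Γ c.K (c.Ψ 3) c.σ) :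
    Real34Junctions hHD hI h₁ h₃ h hA W S μ V c hV :=
  { J with
    gen_mem := Real34Loc.gen_mem_of_dense hHD hI h₁ h₃ h hA W S μ V c hV J hP hspan
    hι := hι
    hU₂ := hU₂
    hU₃ := hU₃ }

/-- **`Real34Junctions` from a `J.wset`-compatible Qaut core** (§ 2), `hι` and C3 for types `2`, `3`. -/
def Real34Loc.junctions_of_qautCore (J : Real34Loc hHD hI h₁ h₃ h hA W S μ V c hV)
    (B : (pinT hHD hI h₁ h₃ h hA W S μ).QautCore V c ((pinT hHD hI h₁ h₃ h hA W S μ).t34 V c))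
    (hB : B.wset ⊆ (Submodule.span ℂ J.wset : Set ((pinT hHD hI h₁ h₃ h hA W S μ).HG L ι₁ V)))
    (hι : ∀ u : U21, (S V c).ιinf u =
      Adelic.regimeEquiv L V.Hm hV (archSectionU21CM (L : Type) ι₁ V.Hm V.sylvesterFrame (sylvesterFrame_J V) u))
    (hU₂ : ∀ Γ : Level V, (pinT hHD hI h₁ h₃ h hA W S μ).Theta V c 2 Γ ⊆ (picardCMUniverse hHD hI h₁ h₃).Uiso Γ c.K (c.Ψ 2) c.σ)
    (hU₃ : ∀ Γ : Level V, (pinT hHD hI h₁ h₃ h hA W S μ).Theta V c 3 Γ ⊆ (picardCMUniverse hHD hI h₁ h₃).Uiso Γ c.K (c.Ψ 3) c.σ) :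
    Real34Junctions hHD hI h₁ h₃ h hA W S μ V c hV :=
  { J with
    gen_mem := Real34Loc.gen_mem_of_qautCore hHD hI h₁ h₃ h hA W S μ V c hV J B hB
    hι := hι
    hU₂ := hU₂
    hU₃ := hU₃ }

/-! ## 4. The pure-tensor junction: (K34) from the (34) see-saw, the K-type decomposition and the class witnesses

The finite-sum statement of § 1 on a dense `P`, UNFOLDED one level in the producers' currencies (model1-g7 (K34-elig) input map):
for `Φ ∈ 𝒮^κ` whose underlying Schwartz–Bruhat function is a finite combination of WEDGE TENSORS `τ φ₂⁰ φ₃¹ − τ φ₂¹ φ₃⁰` of FRAME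
VECTORS `toThetaTop φⱼᵃ = jⱼ (ιⱼ e_a)` of `K`-type situations of lines `2`, `3`, the W-torus period is the `2 × 2` determinant of the four
line periods ((SS₃₄) = binder-1 #8 integrated), each line period is a coordinate of a generating theta form `θ(j, χ′⁻¹)` (binder-1 #5
`coord_thetaForm_eq_integral`), so E's generator `ϑ₃₄(χ, Φ)` IS `ν_T(𝓕_T) •` the combination of realised global wedge-functions
`realise (θ(j₂, χ′₂⁻¹) ∧ θ(j₃, χ′₃⁻¹))` (`t34_ϑ_eq_smul_sum_realise_wedge₂`), which lie in `J.wset` as soon as those theta forms are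
`J.Rep`-admissible (`hRep`; `Real34Loc.realise_wedge₂_mem_wset`).  Main: **`Real34Loc.gen_mem_of_kType`**.
-/

local notation3 "L⁺" => maximalRealSubfield (L : Type)

/-- **From a W-torus-period identity to an `L²` identity**: the (34) generator is `(ν_T(𝓕_T) · a) • realise F` as soon as its W-torus period is `a · F(x⁻¹)` pointwise. -/
theorem t34_ϑ_eq_smul_realise_of_torusPeriodW₃₄ (hW : IsAnisotropic L c.D.gramW)
    (χ : ((pinT hHD hI h₁ h₃ h hA W S μ).t34 V c).X) (Φ : (pinT hHD hI h₁ h₃ h hA W S μ).SK V c)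
    (F : (quotU V).leftInvCont) (a : ℂ)
    (hF : ∀ x : ↥(Adelic.regimeSubgroup L V.Hm),
      torusPeriodW₃₄ (W V c) χ.1 Φ.1 (x : ↥(Adelic.adelicUnitaryGroup L V.Hm)) = a * (F : (quotU V).G → ℂ) x⁻¹) :
    ((pinT hHD hI h₁ h₃ h hA W S μ).t34 V c).ϑ χ Φ =
      ((((SeesawTorus.haar L⁺ L (SeesawTorus.fundamentalDomain L⁺ L)).toReal : ℝ) : ℂ) * a) • (quotU V).realise F := by
  rw [t34_ϑ_eq_toLp, (quotU V).realise_apply, ← map_smul]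
  congr 1
  ext q
  induction q using QuotientGroup.induction_on with
  | H x =>
    rw [t34_ϑc_mk_eq_smul_torusPeriodW₃₄ hHD hI h₁ h₃ h hA W S μ V c hW χ Φ x, hF x, ContinuousMap.smul_apply,
      (quotU V).descendInv_mk, Complex.real_smul, smul_eq_mul, mul_assoc]

local notation3 "𝕏" => pinX hHD hI h₁ h₃ S V c hV
local notation3 "𝕌" => (↥(Literature.NumberTheory.Automorphic.relNormOneIdeles (𝕏).K (𝕏).L) ⧸
  Literature.NumberTheory.Automorphic.relNormOneRat (𝕏).K (𝕏).L)
local notation3 "d𝕌" => Literature.NumberTheory.Automorphic.probHaarRelNormOneQuot (𝕏).K (𝕏).L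

/-- **The W-torus period of a WEDGE TENSOR `τ φ₂ ψ₃ − τ ψ₂ φ₃` is the `2 × 2` determinant of the four line periods** ((SS₃₄) integrated, binder-1's `integral_mul_integral_eq_torusPeriodW₃₄`, twice). -/
theorem torusPeriodW₃₄_wedgeTensor (H : SeesawHyp34 W S V c)
    (φ₂ ψ₂ φ₃ ψ₃ : piSchwartzBruhat (𝕏).K (Fin 3)) (χ₂ χ₃ : PontryaginDual 𝕌) (x : ↥(Adelic.regimeSubgroup L V.Hm)) :
    torusPeriodW₃₄ (W V c) (SeesawTorus.charPair χ₂ χ₃) (H.τ φ₂ ψ₃ - H.τ ψ₂ φ₃) (x : ↥(Adelic.adelicUnitaryGroup L V.Hm)) =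
      (∫ q, ((𝕏).P 2).kernelDatum.thetaKer (((𝕏).P 2).weilDatum.toThetaTop φ₂) (QuotientGroup.mk x, q⁻¹) * ((χ₂ q : Circle) : ℂ) ∂d𝕌) *
        (∫ q, ((𝕏).P 3).kernelDatum.thetaKer (((𝕏).P 3).weilDatum.toThetaTop ψ₃) (QuotientGroup.mk x, q⁻¹) * ((χ₃ q : Circle) : ℂ) ∂d𝕌) -
      (∫ q, ((𝕏).P 2).kernelDatum.thetaKer (((𝕏).P 2).weilDatum.toThetaTop ψ₂) (QuotientGroup.mk x, q⁻¹) * ((χ₂ q : Circle) : ℂ) ∂d𝕌) *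
        (∫ q, ((𝕏).P 3).kernelDatum.thetaKer (((𝕏).P 3).weilDatum.toThetaTop φ₃) (QuotientGroup.mk x, q⁻¹) * ((χ₃ q : Circle) : ℂ) ∂d𝕌) := by
  rw [torusPeriodW₃₄_sub, ← integral_mul_integral_eq_torusPeriodW₃₄ hHD hI h₁ h₃ W S V c hV H φ₂ ψ₃ χ₂ χ₃ x,
    ← integral_mul_integral_eq_torusPeriodW₃₄ hHD hI h₁ h₃ W S V c hV H ψ₂ φ₃ χ₂ χ₃ x]

/-- **A line period of a test vector that IS a frame vector `j (ι eᵢ)` of a `K`-type situation is the `i`-th coordinate at `x⁻¹`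
of the generating theta form `θ(j, χ′⁻¹)`** (binder-1's `coord_thetaForm_eq_integral`). -/
theorem linePeriod_eq_coord_thetaGenElt (k : Fin 4) (Γ : Level V)
    (Sit : KTypeSituation ((𝕏).P k) ((𝕏).ιinf Γ) ((𝕏).Δ Γ) (𝕏).κ₁ (𝕏).τ₁)
    (j : {j : Sit.E →ₗ[ℂ] ((𝕏).P k).weilDatum.ThetaTop // ((𝕏).P k).kernelDatum.IsThetaEquivariant Sit.κ Sit.σ j})
    (χ' : PontryaginDual 𝕌) (i : Fin 2) (φ : piSchwartzBruhat (𝕏).K (Fin 3))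
    (hφ : ((𝕏).P k).weilDatum.toThetaTop φ = j.1 (Sit.ι (LinearMap.proj i))) (x : ↥(Adelic.regimeSubgroup L V.Hm)) :
    (∫ q, ((𝕏).P k).kernelDatum.thetaKer (((𝕏).P k).weilDatum.toThetaTop φ) (QuotientGroup.mk x, q⁻¹) * ((χ' q : Circle) : ℂ) ∂d𝕌) =
      (thetaGenElt hHD hI h₁ h₃ S V c hV Γ k Sit j (WeilPairData.charInv χ') : (quotU V).G → (Fin 2 → ℂ)) x⁻¹ i := by
  rw [hφ]
  exact (coord_thetaForm_eq_integral hHD hI h₁ h₃ S V c hV k Γ Sit j χ' i x).symm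

/-- **ONE WEDGE TENSOR.**  If `Φ ∈ 𝒮^κ` is the wedge tensor `τ φ₂⁰ φ₃¹ − τ φ₂¹ φ₃⁰` of test vectors that are the frame vectors
`j₂ (ι₂ eᵢ)`, `j₃ (ι₃ eᵢ)` of `K`-type situations of lines `2`, `3`, then E's (34) generator at `χ = χ₂ ⊠ χ₃` IS `ν_T(𝓕_T) •` the realised
global wedge-function of the two generating theta forms `θ(j₂, χ₂⁻¹)`, `θ(j₃, χ₃⁻¹)`. -/
theorem t34_ϑ_wedgeTensor_eq_smul_realise (hW : IsAnisotropic L c.D.gramW) (H : SeesawHyp34 W S V c)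
    {Γ₂ Γ₃ : Level V}
    (Sit₂ : KTypeSituation ((𝕏).P 2) ((𝕏).ιinf Γ₂) ((𝕏).Δ Γ₂) (𝕏).κ₁ (𝕏).τ₁)
    (j₂ : {j : Sit₂.E →ₗ[ℂ] ((𝕏).P 2).weilDatum.ThetaTop // ((𝕏).P 2).kernelDatum.IsThetaEquivariant Sit₂.κ Sit₂.σ j})
    (Sit₃ : KTypeSituation ((𝕏).P 3) ((𝕏).ιinf Γ₃) ((𝕏).Δ Γ₃) (𝕏).κ₁ (𝕏).τ₁)
    (j₃ : {j : Sit₃.E →ₗ[ℂ] ((𝕏).P 3).weilDatum.ThetaTop // ((𝕏).P 3).kernelDatum.IsThetaEquivariant Sit₃.κ Sit₃.σ j})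
    (χ₂ χ₃ : PontryaginDual 𝕌)
    (hX : SeesawTorus.charPair χ₂ χ₃ ∈ SeesawTorus.allowedChars (L : Type) (d34Of μ c).m₁ (d34Of μ c).m₂)
    (φ₂ φ₃ : Fin 2 → piSchwartzBruhat (𝕏).K (Fin 3))
    (hφ₂ : ∀ i, ((𝕏).P 2).weilDatum.toThetaTop (φ₂ i) = j₂.1 (Sit₂.ι (LinearMap.proj i)))
    (hφ₃ : ∀ i, ((𝕏).P 3).weilDatum.toThetaTop (φ₃ i) = j₃.1 (Sit₃.ι (LinearMap.proj i)))
    (Φ : (pinT hHD hI h₁ h₃ h hA W S μ).SK V c) (hΦ : Φ.1 = H.τ (φ₂ 0) (φ₃ 1) - H.τ (φ₂ 1) (φ₃ 0)) :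
    ((pinT hHD hI h₁ h₃ h hA W S μ).t34 V c).ϑ
        (⟨SeesawTorus.charPair χ₂ χ₃, hX⟩ : ((pinT hHD hI h₁ h₃ h hA W S μ).t34 V c).X) Φ =
      (((SeesawTorus.haar L⁺ L (SeesawTorus.fundamentalDomain L⁺ L)).toReal : ℝ) : ℂ) •
        (quotU V).realise ((quotU V).wedge₂
          (thetaGenElt hHD hI h₁ h₃ S V c hV Γ₂ 2 Sit₂ j₂ (WeilPairData.charInv χ₂))
          (thetaGenElt hHD hI h₁ h₃ S V c hV Γ₃ 3 Sit₃ j₃ (WeilPairData.charInv χ₃))) := by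
  have key := t34_ϑ_eq_smul_realise_of_torusPeriodW₃₄ hHD hI h₁ h₃ h hA W S μ V c hW
    (⟨SeesawTorus.charPair χ₂ χ₃, hX⟩ : ((pinT hHD hI h₁ h₃ h hA W S μ).t34 V c).X) Φ
    ((quotU V).wedge₂ (thetaGenElt hHD hI h₁ h₃ S V c hV Γ₂ 2 Sit₂ j₂ (WeilPairData.charInv χ₂))
      (thetaGenElt hHD hI h₁ h₃ S V c hV Γ₃ 3 Sit₃ j₃ (WeilPairData.charInv χ₃))) 1 ?_
  · rw [key, mul_one]
  intro x
  rw [hΦ, one_mul, (quotU V).coe_wedge₂]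
  show torusPeriodW₃₄ (W V c) (SeesawTorus.charPair χ₂ χ₃) (H.τ (φ₂ 0) (φ₃ 1) - H.τ (φ₂ 1) (φ₃ 0)) _ = _
  rw [torusPeriodW₃₄_wedgeTensor hHD hI h₁ h₃ W S V c hV H,
    linePeriod_eq_coord_thetaGenElt hHD hI h₁ h₃ S V c hV 2 Γ₂ Sit₂ j₂ χ₂ 0 (φ₂ 0) (hφ₂ 0) x,
    linePeriod_eq_coord_thetaGenElt hHD hI h₁ h₃ S V c hV 2 Γ₂ Sit₂ j₂ χ₂ 1 (φ₂ 1) (hφ₂ 1) x,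
    linePeriod_eq_coord_thetaGenElt hHD hI h₁ h₃ S V c hV 3 Γ₃ Sit₃ j₃ χ₃ 0 (φ₃ 0) (hφ₃ 0) x,
    linePeriod_eq_coord_thetaGenElt hHD hI h₁ h₃ S V c hV 3 Γ₃ Sit₃ j₃ χ₃ 1 (φ₃ 1) (hφ₃ 1) x]
  rfl

/-- `torusPeriodW₃₄` of a finite linear combination. -/
theorem torusPeriodW₃₄_sum_smul {D : StubTree.SeesawDatum L} (W' : WmInput V D) {n : ℕ}
    (χ : PontryaginDual (SeesawTorus L⁺ L ⧸ SeesawTorus.rat L⁺ L)) (a : Fin n → ℂ)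
    (Ψ : Fin n → piSchwartzBruhat W'.F W'.ι) (x : ↥(Adelic.adelicUnitaryGroup L V.Hm)) :
    torusPeriodW₃₄ W' χ (∑ i, a i • Ψ i) x = ∑ i, a i * torusPeriodW₃₄ W' χ (Ψ i) x := by
  classical
  induction (Finset.univ : Finset (Fin n)) using Finset.induction_on with
  | empty =>
    rw [Finset.sum_empty, Finset.sum_empty, ← zero_smul ℂ (0 : piSchwartzBruhat W'.F W'.ι), torusPeriodW₃₄_smul, zero_mul]
  | insert i s hi ih => rw [Finset.sum_insert hi, Finset.sum_insert hi, torusPeriodW₃₄_add, torusPeriodW₃₄_smul, ih]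

/-- **FINITE SUMS OF WEDGE TENSORS.**  For `Φ ∈ 𝒮^κ` with `Φ = Σᵢ λᵢ • (τ φ₂ᵢ⁰ φ₃ᵢ¹ − τ φ₂ᵢ¹ φ₃ᵢ⁰)` over frame vectors of `K`-type
situations of lines `2`, `3` (at levels `Γᵢ`), E's (34) generator at ANY character `χ` of `[T]` is `ν_T(𝓕_T) •` the corresponding
combination of realised global wedge-functions of generating theta forms (weight functions `(χ′ⱼ)⁻¹`, `χ′₂ := charFst χ`, `χ′₃ := charSnd χ`). -/
theorem t34_ϑ_eq_smul_sum_realise_wedge₂ (hW : IsAnisotropic L c.D.gramW) (H : SeesawHyp34 W S V c) {n : ℕ}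
    (Γ' : Fin n → Level V)
    (Sit₂ : ∀ i, KTypeSituation ((𝕏).P 2) ((𝕏).ιinf (Γ' i)) ((𝕏).Δ (Γ' i)) (𝕏).κ₁ (𝕏).τ₁)
    (j₂ : ∀ i, {j : (Sit₂ i).E →ₗ[ℂ] ((𝕏).P 2).weilDatum.ThetaTop // ((𝕏).P 2).kernelDatum.IsThetaEquivariant (Sit₂ i).κ (Sit₂ i).σ j})
    (Sit₃ : ∀ i, KTypeSituation ((𝕏).P 3) ((𝕏).ιinf (Γ' i)) ((𝕏).Δ (Γ' i)) (𝕏).κ₁ (𝕏).τ₁)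
    (j₃ : ∀ i, {j : (Sit₃ i).E →ₗ[ℂ] ((𝕏).P 3).weilDatum.ThetaTop // ((𝕏).P 3).kernelDatum.IsThetaEquivariant (Sit₃ i).κ (Sit₃ i).σ j})
    (φ₂ φ₃ : Fin n → Fin 2 → piSchwartzBruhat (𝕏).K (Fin 3))
    (hφ₂ : ∀ i a, ((𝕏).P 2).weilDatum.toThetaTop (φ₂ i a) = (j₂ i).1 ((Sit₂ i).ι (LinearMap.proj a)))
    (hφ₃ : ∀ i a, ((𝕏).P 3).weilDatum.toThetaTop (φ₃ i a) = (j₃ i).1 ((Sit₃ i).ι (LinearMap.proj a)))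
    (a : Fin n → ℂ) (χ : ((pinT hHD hI h₁ h₃ h hA W S μ).t34 V c).X) (Φ : (pinT hHD hI h₁ h₃ h hA W S μ).SK V c)
    (hΦ : Φ.1 = ∑ i, a i • (H.τ (φ₂ i 0) (φ₃ i 1) - H.τ (φ₂ i 1) (φ₃ i 0))) :
    ((pinT hHD hI h₁ h₃ h hA W S μ).t34 V c).ϑ χ Φ =
      (((SeesawTorus.haar L⁺ L (SeesawTorus.fundamentalDomain L⁺ L)).toReal : ℝ) : ℂ) •
        ∑ i, a i • (quotU V).realise ((quotU V).wedge₂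
          (thetaGenElt hHD hI h₁ h₃ S V c hV (Γ' i) 2 (Sit₂ i) (j₂ i) (WeilPairData.charInv (SeesawTorus.charFst χ.1)))
          (thetaGenElt hHD hI h₁ h₃ S V c hV (Γ' i) 3 (Sit₃ i) (j₃ i) (WeilPairData.charInv (SeesawTorus.charSnd χ.1)))) := by
  have key := t34_ϑ_eq_smul_realise_of_torusPeriodW₃₄ hHD hI h₁ h₃ h hA W S μ V c hW χ Φ
    (∑ i, a i • (quotU V).wedge₂
      (thetaGenElt hHD hI h₁ h₃ S V c hV (Γ' i) 2 (Sit₂ i) (j₂ i) (WeilPairData.charInv (SeesawTorus.charFst χ.1)))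
      (thetaGenElt hHD hI h₁ h₃ S V c hV (Γ' i) 3 (Sit₃ i) (j₃ i) (WeilPairData.charInv (SeesawTorus.charSnd χ.1)))) 1 ?_
  · rw [key, mul_one, map_sum]
    simp_rw [map_smul]
  · intro x
    rw [hΦ, one_mul, torusPeriodW₃₄_sum_smul, Submodule.coe_sum, Finset.sum_apply]
    refine Finset.sum_congr rfl fun i _ => ?_
    rw [Submodule.coe_smul, Pi.smul_apply, smul_eq_mul, (quotU V).coe_wedge₂]
    congr 1
    conv_lhs => rw [← SeesawTorus.charPair_charFst_charSnd χ.1]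
    rw [torusPeriodW₃₄_wedgeTensor hHD hI h₁ h₃ W S V c hV H,
      linePeriod_eq_coord_thetaGenElt hHD hI h₁ h₃ S V c hV 2 (Γ' i) (Sit₂ i) (j₂ i) _ 0 (φ₂ i 0) (hφ₂ i 0) x,
      linePeriod_eq_coord_thetaGenElt hHD hI h₁ h₃ S V c hV 2 (Γ' i) (Sit₂ i) (j₂ i) _ 1 (φ₂ i 1) (hφ₂ i 1) x,
      linePeriod_eq_coord_thetaGenElt hHD hI h₁ h₃ S V c hV 3 (Γ' i) (Sit₃ i) (j₃ i) _ 0 (φ₃ i 0) (hφ₃ i 0) x,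
      linePeriod_eq_coord_thetaGenElt hHD hI h₁ h₃ S V c hV 3 (Γ' i) (Sit₃ i) (j₃ i) _ 1 (φ₃ i 1) (hφ₃ i 1) x]
    rfl

/-- **(K34) JUNCTION THEOREM.** `gen_mem` over `J.wset` from: (α) the (34) see-saw hypotheses `H : SeesawHyp34` (binder-1 #8's record;
period-1's (S-restr) lines `k = 2, 3`); `hRep` — every generating theta form `θ(j, χ′⁻¹)` of an ADMISSIBLE `K`-type situation of line `k`
at level `Γ₀` is `J.Rep`-admissible (DEFINITIONAL for binder-1's RUN-37 instance `Rep Γ i G := G ∈ span (thetaGen Γ i adm)`: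
`Submodule.subset_span (thetaGenElt_mem …)`); and the K-TYPE CONTENT of PerL Lemma 3.5 (34): a DENSE subset `P ⊆ 𝒮^κ` (`hP`, (γ)) on
which every test function is a finite linear combination of WEDGE TENSORS `τ φ₂⁰ φ₃¹ − τ φ₂¹ φ₃⁰` of frame vectors of admissible situations
of lines `2`, `3` at a common level (`hdec`, (β)). -/
theorem Real34Loc.gen_mem_of_kType (J : Real34Loc hHD hI h₁ h₃ h hA W S μ V c hV)
    (hW : IsAnisotropic L c.D.gramW) (H : SeesawHyp34 W S V c)
    (adm : ∀ (Γ : Level V) (k : Fin 4), KTypeSituation ((𝕏).P k) ((𝕏).ιinf Γ) ((𝕏).Δ Γ) (𝕏).κ₁ (𝕏).τ₁ → Prop)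
    (hRep : ∀ (Γ₀ : Level V) (k : Fin 4) (Sit : KTypeSituation ((𝕏).P k) ((𝕏).ιinf Γ₀) ((𝕏).Δ Γ₀) (𝕏).κ₁ (𝕏).τ₁),
      adm Γ₀ k Sit → ∀ j ∈ Sit.𝓙, ∀ χ' : PontryaginDual 𝕌,
        J.Rep Γ₀ k (thetaGenElt hHD hI h₁ h₃ S V c hV Γ₀ k Sit j (WeilPairData.charInv χ')))
    (P : Set ((pinT hHD hI h₁ h₃ h hA W S μ).SK V c)) (hP : Dense P)
    (hdec : ∀ Φ ∈ P, ∃ (n : ℕ) (Γ' : Fin n → Level V)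
      (Sit₂ : ∀ i, KTypeSituation ((𝕏).P 2) ((𝕏).ιinf (Γ' i)) ((𝕏).Δ (Γ' i)) (𝕏).κ₁ (𝕏).τ₁)
      (j₂ : ∀ i, {j : (Sit₂ i).E →ₗ[ℂ] ((𝕏).P 2).weilDatum.ThetaTop // ((𝕏).P 2).kernelDatum.IsThetaEquivariant (Sit₂ i).κ (Sit₂ i).σ j})
      (Sit₃ : ∀ i, KTypeSituation ((𝕏).P 3) ((𝕏).ιinf (Γ' i)) ((𝕏).Δ (Γ' i)) (𝕏).κ₁ (𝕏).τ₁)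
      (j₃ : ∀ i, {j : (Sit₃ i).E →ₗ[ℂ] ((𝕏).P 3).weilDatum.ThetaTop // ((𝕏).P 3).kernelDatum.IsThetaEquivariant (Sit₃ i).κ (Sit₃ i).σ j})
      (φ₂ φ₃ : Fin n → Fin 2 → piSchwartzBruhat (𝕏).K (Fin 3)) (a : Fin n → ℂ),
      (∀ i, adm (Γ' i) 2 (Sit₂ i) ∧ j₂ i ∈ (Sit₂ i).𝓙 ∧ adm (Γ' i) 3 (Sit₃ i) ∧ j₃ i ∈ (Sit₃ i).𝓙) ∧
      (∀ i a', ((𝕏).P 2).weilDatum.toThetaTop (φ₂ i a') = (j₂ i).1 ((Sit₂ i).ι (LinearMap.proj a'))) ∧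
      (∀ i a', ((𝕏).P 3).weilDatum.toThetaTop (φ₃ i a') = (j₃ i).1 ((Sit₃ i).ι (LinearMap.proj a'))) ∧
      Φ.1 = ∑ i, a i • (H.τ (φ₂ i 0) (φ₃ i 1) - H.τ (φ₂ i 1) (φ₃ i 0))) :
    ∀ (χ : ((pinT hHD hI h₁ h₃ h hA W S μ).t34 V c).X) (Φ : (pinT hHD hI h₁ h₃ h hA W S μ).SK V c),
      ((pinT hHD hI h₁ h₃ h hA W S μ).t34 V c).ϑ χ Φ ∈ (Submodule.span ℂ J.wset).topologicalClosure := by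
  refine Real34Loc.gen_mem_of_dense hHD hI h₁ h₃ h hA W S μ V c hV J hP fun χ Φ hΦ => ?_
  obtain ⟨n, Γ', Sit₂, j₂, Sit₃, j₃, φ₂, φ₃, a, hadm, hφ₂, hφ₃, hΦ1⟩ := hdec Φ hΦ
  rw [t34_ϑ_eq_smul_sum_realise_wedge₂ hHD hI h₁ h₃ h hA W S μ V c hV hW H Γ' Sit₂ j₂ Sit₃ j₃ φ₂ φ₃ hφ₂ hφ₃ a χ Φ hΦ1]
  refine Submodule.smul_mem _ _ (Submodule.sum_mem _ fun i _ => Submodule.smul_mem _ _ (Submodule.subset_span ?_))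
  exact J.realise_wedge₂_mem_wset
    (hRep (Γ' i) 2 (Sit₂ i) (hadm i).1 (j₂ i) (hadm i).2.1 (SeesawTorus.charFst χ.1))
    (hRep (Γ' i) 3 (Sit₃ i) (hadm i).2.2.1 (j₃ i) (hadm i).2.2.2 (SeesawTorus.charSnd χ.1))

/-- **`Real34Junctions` from the (K34) junction theorem** (§ 4), `hι` and C3 for types `2`, `3`. -/
theorem Real34Loc.nonempty_junctions_of_kType (J : Real34Loc hHD hI h₁ h₃ h hA W S μ V c hV)
    (hW : IsAnisotropic L c.D.gramW) (H : SeesawHyp34 W S V c)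
    (adm : ∀ (Γ : Level V) (k : Fin 4), KTypeSituation ((𝕏).P k) ((𝕏).ιinf Γ) ((𝕏).Δ Γ) (𝕏).κ₁ (𝕏).τ₁ → Prop)
    (hRep : ∀ (Γ₀ : Level V) (k : Fin 4) (Sit : KTypeSituation ((𝕏).P k) ((𝕏).ιinf Γ₀) ((𝕏).Δ Γ₀) (𝕏).κ₁ (𝕏).τ₁),
      adm Γ₀ k Sit → ∀ j ∈ Sit.𝓙, ∀ χ' : PontryaginDual 𝕌,
        J.Rep Γ₀ k (thetaGenElt hHD hI h₁ h₃ S V c hV Γ₀ k Sit j (WeilPairData.charInv χ')))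
    (P : Set ((pinT hHD hI h₁ h₃ h hA W S μ).SK V c)) (hP : Dense P)
    (hdec : ∀ Φ ∈ P, ∃ (n : ℕ) (Γ' : Fin n → Level V)
      (Sit₂ : ∀ i, KTypeSituation ((𝕏).P 2) ((𝕏).ιinf (Γ' i)) ((𝕏).Δ (Γ' i)) (𝕏).κ₁ (𝕏).τ₁)
      (j₂ : ∀ i, {j : (Sit₂ i).E →ₗ[ℂ] ((𝕏).P 2).weilDatum.ThetaTop // ((𝕏).P 2).kernelDatum.IsThetaEquivariant (Sit₂ i).κ (Sit₂ i).σ j})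
      (Sit₃ : ∀ i, KTypeSituation ((𝕏).P 3) ((𝕏).ιinf (Γ' i)) ((𝕏).Δ (Γ' i)) (𝕏).κ₁ (𝕏).τ₁)
      (j₃ : ∀ i, {j : (Sit₃ i).E →ₗ[ℂ] ((𝕏).P 3).weilDatum.ThetaTop // ((𝕏).P 3).kernelDatum.IsThetaEquivariant (Sit₃ i).κ (Sit₃ i).σ j})
      (φ₂ φ₃ : Fin n → Fin 2 → piSchwartzBruhat (𝕏).K (Fin 3)) (a : Fin n → ℂ),
      (∀ i, adm (Γ' i) 2 (Sit₂ i) ∧ j₂ i ∈ (Sit₂ i).𝓙 ∧ adm (Γ' i) 3 (Sit₃ i) ∧ j₃ i ∈ (Sit₃ i).𝓙) ∧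
      (∀ i a', ((𝕏).P 2).weilDatum.toThetaTop (φ₂ i a') = (j₂ i).1 ((Sit₂ i).ι (LinearMap.proj a'))) ∧
      (∀ i a', ((𝕏).P 3).weilDatum.toThetaTop (φ₃ i a') = (j₃ i).1 ((Sit₃ i).ι (LinearMap.proj a'))) ∧
      Φ.1 = ∑ i, a i • (H.τ (φ₂ i 0) (φ₃ i 1) - H.τ (φ₂ i 1) (φ₃ i 0)))
    (hι : ∀ u : U21, (S V c).ιinf u =
      Adelic.regimeEquiv L V.Hm hV (archSectionU21CM (L : Type) ι₁ V.Hm V.sylvesterFrame (sylvesterFrame_J V) u))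
    (hU₂ : ∀ Γ : Level V, (pinT hHD hI h₁ h₃ h hA W S μ).Theta V c 2 Γ ⊆ (picardCMUniverse hHD hI h₁ h₃).Uiso Γ c.K (c.Ψ 2) c.σ)
    (hU₃ : ∀ Γ : Level V, (pinT hHD hI h₁ h₃ h hA W S μ).Theta V c 3 Γ ⊆ (picardCMUniverse hHD hI h₁ h₃).Uiso Γ c.K (c.Ψ 3) c.σ) :
    Nonempty (Real34Junctions hHD hI h₁ h₃ h hA W S μ V c hV) :=
  ⟨{ J with
      gen_mem := Real34Loc.gen_mem_of_kType hHD hI h₁ h₃ h hA W S μ V c hV J hW H adm hRep P hP hdec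
      hι := hι
      hU₂ := hU₂
      hU₃ := hU₃ }⟩

end Model

end HodgeCM

end
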